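import Summits.QuantumFields.GaugeBoot.DiagonalRPTorusWordGlue
import Summits.QuantumFields.GaugeBoot.DiagonalRPTorusHexLocal
import HarnessLib

/-!
# Lattice words in the local `ℤ³` chart (gauge-boot, L3 `d = 3` uniform window, J2 brick 2)

HONEST FRAMING (cell `pub-gaugeboot`, page 1 of every file): the venture produces certified bounds
on lattice expectations at stated coupling, gauge group, dimension and torus size; NOT a mass gap,
NOT a continuum limit, NOT a string tension; NOT Yang–Mills-summit-bearing (barriers
`FixedCouplingUltralocality`, `PerturbativeInvisibility`). This module is bookkeeping for a
structural NEGATIVE result (a coupling window UNIFORM in the torus size for the failure of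
inner-half diagonal reflection positivity on `(ℤ/L)^3`, plan note
`HOME/pub-gaugeboot-lean3/gen46/D3-UNIFORM-PLAN.md` §3 item 6c (J2)); it discharges nothing by
itself.

## Content (chart `DiagRPHex.site y` of `DiagonalRPTorusHexLocal`, torus `(ℤ/L)^3`)

The rules of `DiagonalRPTorusWordGlue` ask for `Word.Split` data and non-reading facts on the
torus; here they are produced from DECIDABLE data on words based at local sites:

* `lapply`, `ledge`, `lendpoint`, `ledges` — the local mirrors of `Step.apply`, `Step.edge`,
  `Word.endpoint`, `Word.edgesRead`, and their transport through the chart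
  (`apply_site`, `edge_site`, `endpoint_site`, `edgesRead_site`);
* `count_edgesRead_site` — on the box (where the chart is injective) the multiplicity of a charted
  link among the links read on the torus is its local multiplicity; `not_mem_edgesRead_of_count`;
* ★ `splitAt` — an explicit `Word.Split (site y x) w (edge y ℓ)` from a position `k` with
  `(ledges x w)[k] = ℓ` of local multiplicity one;
* `chartWords` — charting a list of locally based words, `wlInt` of which is what the script
  checker of brick 3 evaluates.

Elementary bookkeeping; no named fact.
-/

open Finset Function

namespace Summit.QuantumFields.GaugeBoot

open Literature.MathematicalPhysics.QuantumFieldTheory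

namespace DiagRPHex

/-! ## Local step semantics -/

/-- Endpoint of a step taken from a local site. -/
def lapply (x : LSite) : Step 3 → LSite
  | .fwd μ => x + lvec μ
  | .bwd μ => x - lvec μ

/-- The (positively oriented) local link traversed by a step. -/
def ledge (x : LSite) : Step 3 → LEdge
  | .fwd μ => (x, μ)
  | .bwd μ => (x - lvec μ, μ)

/-- Endpoint of a word read from a local site. -/
def lendpoint : LSite → Word 3 → LSite
  | x, [] => x
  | x, s :: w => lendpoint (lapply x s) w

/-- The local links read by a word, in order, with multiplicity. -/
def ledges : LSite → Word 3 → List LEdge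
  | _, [] => []
  | x, s :: w => ledge x s :: ledges (lapply x s) w

/-- `ledges` of a concatenation. -/
theorem ledges_append (x : LSite) (v w : Word 3) :
    ledges x (v ++ w) = ledges x v ++ ledges (lendpoint x v) w := by
  induction v generalizing x with
  | nil => rfl
  | cons s v ih => simp [ledges, lendpoint, ih]

/-- `lendpoint` of a concatenation. -/
theorem lendpoint_append (x : LSite) (v w : Word 3) :
    lendpoint x (v ++ w) = lendpoint (lendpoint x v) w := by
  induction v generalizing x with
  | nil => rfl
  | cons s v ih => simp [lendpoint, ih]

/-- A word reads as many links as it has steps. -/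
@[simp] theorem length_ledges (x : LSite) (w : Word 3) : (ledges x w).length = w.length := by
  induction w generalizing x with
  | nil => rfl
  | cons s w ih => simp [ledges, ih]

/-- The link at position `k` is read by the step at position `k` from the endpoint of the prefix. -/
theorem ledges_getElem (x : LSite) (w : Word 3) (k : ℕ) (hk : k < w.length) :
    (ledges x w)[k]'(by simpa using hk) = ledge (lendpoint x (w.take k)) (w[k]) := by
  induction w generalizing x k with
  | nil => simp at hk
  | cons s w ih =>
    cases k with
    | zero => simp [ledges, lendpoint]
    | succ k =>
      simp only [ledges, List.getElem_cons_succ, List.take_succ_cons, lendpoint]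
      exact ih (lapply x s) k (by simpa using hk)

/-! ## Transport through the chart -/

section Chart

variable {L : ℕ} (y : Site 3 L)

/-- `site y (x - e_μ) = site y x - e_μ`. -/
theorem site_sub_lvec (x : LSite) (μ : Fin 3) : site y (x - lvec μ) = site y x - Pi.single μ 1 := by
  have h := site_add_lvec y (x - lvec μ) μ
  rw [sub_add_cancel] at h
  rw [h]; simp [Site.shift]

/-- Steps commute with the chart: endpoints. -/
theorem apply_site (x : LSite) (s : Step 3) : s.apply (site y x) = site y (lapply x s) := by
  cases s with
  | fwd μ => simp [Step.apply, lapply, site_add_lvec]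
  | bwd μ => simp [Step.apply, lapply, site_sub_lvec]

/-- Steps commute with the chart: links. -/
theorem edge_site (x : LSite) (s : Step 3) : s.edge (site y x) = edge y (ledge x s) := by
  cases s with
  | fwd μ => simp [Step.edge, ledge, edge]
  | bwd μ => simp [Step.edge, ledge, edge, site_sub_lvec]

/-- Words commute with the chart: endpoints. -/
theorem endpoint_site (x : LSite) (w : Word 3) :
    Word.endpoint (site y x) w = site y (lendpoint x w) := by
  induction w generalizing x with
  | nil => rfl
  | cons s w ih => simp [Word.endpoint, lendpoint, apply_site, ih]

/-- Words commute with the chart: links read. -/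
theorem edgesRead_site (x : LSite) (w : Word 3) :
    Word.edgesRead (site y x) w = (ledges x w).map (edge y) := by
  induction w generalizing x with
  | nil => rfl
  | cons s w ih => simp [Word.edgesRead, ledges, edge_site, apply_site, ih]

/-- All links read lie in the box `B`. [shape] Boolean bookkeeping, not a fact. -/
def ledgesInBox (B : ℕ) (x : LSite) (w : Word 3) : Bool := (ledges x w).all fun ℓ => inBoxB B ℓ.1

/-- ★ On the box the torus multiplicity of a charted link is its local multiplicity. -/
theorem count_edgesRead_site {B : ℕ} (hB : 2 * B < L) {x : LSite} {w : Word 3}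
    (hw : ledgesInBox B x w = true) {ℓ : LEdge} (hℓ : InBox B ℓ.1) :
    (Word.edgesRead (site y x) w).count (edge y ℓ) = (ledges x w).count ℓ := by
  classical
  rw [edgesRead_site]
  simp only [ledgesInBox, List.all_eq_true] at hw
  generalize ledges x w = l at hw ⊢
  induction l with
  | nil => simp
  | cons a l ih =>
    have ha : InBox B a.1 := inBox_of_inBoxB (hw a List.mem_cons_self)
    rw [List.map_cons, List.count_cons, List.count_cons, ih fun b hb => hw b (List.mem_cons_of_mem _ hb)]
    congr 1
    by_cases hal : a = ℓ
    · subst hal; simp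
    · have : edge y a ≠ edge y ℓ := fun h => hal (edge_injOn y hB ha hℓ h)
      simp [hal, this]

/-- A link of local multiplicity zero is not read on the torus (box version). -/
theorem not_mem_edgesRead_of_count {B : ℕ} (hB : 2 * B < L) {x : LSite} {w : Word 3}
    (hw : ledgesInBox B x w = true) {ℓ : LEdge} (hℓ : InBox B ℓ.1) (h0 : (ledges x w).count ℓ = 0) :
    edge y ℓ ∉ Word.edgesRead (site y x) w := by
  classical
  have := count_edgesRead_site y hB hw hℓ
  rw [h0] at this
  exact List.not_mem_of_count_eq_zero this

/-- Links read by a prefix are read by the word. -/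
theorem count_ledges_take_le (x : LSite) (w : Word 3) (k : ℕ) (ℓ : LEdge) [DecidableEq LEdge] :
    (ledges x (w.take k)).count ℓ ≤ (ledges x w).count ℓ := by
  conv_rhs => rw [← List.take_append_drop k w, ledges_append]
  rw [List.count_append]; omega

/-- ★ **An explicit split** of a word at a position reading a link of local multiplicity one. -/
def splitAt {B : ℕ} (hB : 2 * B < L) (x : LSite) (w : Word 3) (k : ℕ) (hk : k < w.length)
    (hw : ledgesInBox B x w = true) (ℓ : LEdge) (hℓ : (ledges x w)[k]'(by simpa using hk) = ℓ)
    (h1 : (ledges x w).count ℓ = 1) : Word.Split (site y x) w (edge y ℓ) := by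
  classical
  have hℓbox : InBox B ℓ.1 := by
    simp only [ledgesInBox, List.all_eq_true] at hw
    exact inBox_of_inBoxB (hw ℓ (hℓ ▸ List.getElem_mem _))
  -- the decomposition `w = take k ++ w[k] :: drop (k+1)` and its local link lists
  have hdec : w = w.take k ++ w[k] :: w.drop (k + 1) := by
    conv_lhs => rw [← List.take_append_drop k w]
    rw [List.drop_eq_getElem_cons hk]
  have hstep : ledge (lendpoint x (w.take k)) (w[k]) = ℓ := by rw [← ledges_getElem x w k hk, hℓ]
  have hsplit : ledges x w = ledges x (w.take k) ++ ℓ :: ledges (lapply (lendpoint x (w.take k)) (w[k]))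
      (w.drop (k + 1)) := by
    conv_lhs => rw [hdec]
    rw [ledges_append, ledges, hstep]
  have hcount := h1
  rw [hsplit, List.count_append, List.count_cons_self] at hcount
  have hpre0 : (ledges x (w.take k)).count ℓ = 0 := by omega
  have hsuf0 : (ledges (lapply (lendpoint x (w.take k)) (w[k])) (w.drop (k + 1))).count ℓ = 0 := by omega
  have hwall : ∀ e ∈ ledges x w, inBoxB B e.1 = true := by
    simpa only [ledgesInBox, List.all_eq_true] using hw
  have hboxpre : ledgesInBox B x (w.take k) = true := by
    simp only [ledgesInBox, List.all_eq_true]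
    intro e he; exact hwall e (by rw [hsplit]; exact List.mem_append_left _ he)
  have hboxsuf : ledgesInBox B (lapply (lendpoint x (w.take k)) (w[k])) (w.drop (k + 1)) = true := by
    simp only [ledgesInBox, List.all_eq_true]
    intro e he
    exact hwall e (by rw [hsplit]; exact List.mem_append_right _ (List.mem_cons_of_mem _ he))
  exact
  { pre := w.take k
    step := w[k]
    suf := w.drop (k + 1)
    eq := hdec
    pre_not_mem := not_mem_edgesRead_of_count y hB hboxpre hℓbox hpre0
    step_edge := by rw [endpoint_site, edge_site, hstep]
    suf_not_mem := by
      rw [endpoint_site, apply_site]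
      exact not_mem_edgesRead_of_count y hB hboxsuf hℓbox hsuf0 }

/-- The prefix of `splitAt`. -/
@[simp] theorem splitAt_pre {B : ℕ} (hB : 2 * B < L) (x : LSite) (w : Word 3) (k : ℕ) (hk : k < w.length)
    (hw : ledgesInBox B x w = true) (ℓ : LEdge) (hℓ : (ledges x w)[k]'(by simpa using hk) = ℓ)
    (h1 : (ledges x w).count ℓ = 1) : (splitAt y hB x w k hk hw ℓ hℓ h1).pre = w.take k := rfl

/-- The step of `splitAt`. -/
@[simp] theorem splitAt_step {B : ℕ} (hB : 2 * B < L) (x : LSite) (w : Word 3) (k : ℕ) (hk : k < w.length)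
    (hw : ledgesInBox B x w = true) (ℓ : LEdge) (hℓ : (ledges x w)[k]'(by simpa using hk) = ℓ)
    (h1 : (ledges x w).count ℓ = 1) : (splitAt y hB x w k hk hw ℓ hℓ h1).step = w[k] := rfl

/-- The suffix of `splitAt`. -/
@[simp] theorem splitAt_suf {B : ℕ} (hB : 2 * B < L) (x : LSite) (w : Word 3) (k : ℕ) (hk : k < w.length)
    (hw : ledgesInBox B x w = true) (ℓ : LEdge) (hℓ : (ledges x w)[k]'(by simpa using hk) = ℓ)
    (h1 : (ledges x w).count ℓ = 1) : (splitAt y hB x w k hk hw ℓ hℓ h1).suf = w.drop (k + 1) := rfl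

/-! ## Charting a list of based words -/

/-- Chart a list of locally based words. -/
def chartWords (ws : List (LSite × Word 3)) : List (Site 3 L × Word 3) :=
  ws.map fun xw => (site y xw.1, xw.2)

/-- `chartWords` of a cons. -/
@[simp] theorem chartWords_cons (xw : LSite × Word 3) (ws : List (LSite × Word 3)) :
    chartWords y (xw :: ws) = (site y xw.1, xw.2) :: chartWords y ws := rfl

/-- `chartWords` of nil. -/
@[simp] theorem chartWords_nil : chartWords y ([] : List (LSite × Word 3)) = [] := rfl

/-- `chartWords` respects permutations. -/
theorem chartWords_perm {ws ws' : List (LSite × Word 3)} (h : ws.Perm ws') :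
    (chartWords y ws).Perm (chartWords y ws') := h.map _

/-- `chartWords` and `erase`. -/
theorem chartWords_erase [DecidableEq (Site 3 L × Word 3)] (ws : List (LSite × Word 3))
    (a : LSite × Word 3) (ha : a ∈ ws) :
    (chartWords y ws).Perm ((site y a.1, a.2) :: chartWords y (ws.erase a)) := by
  have h := chartWords_perm y (List.perm_cons_erase ha)
  simpa [chartWords] using h

end Chart

end DiagRPHex

end Summit.QuantumFields.GaugeBoot
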